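import Summits.Ventures.HSemireg.WedgeHankelRecurrenceGaussChebyshevCResultantClosed

/-!
# Venture HSemireg — **WHICH CHEBYSHEV NODES COINCIDE, POINTWISE AND OVER EVERY COMMUTATIVE RING**: from the ideal identities N457 ∕ N458 ∕ N462 ∕ N465 ∕ N466, for every `x` in the ring:
# `U_{m−1}(x) = U_{n−1}(x) = 0 ⟺ U_{gcd(m,n)−1}(x) = 0` (second-kind ∕ Fejér nodes; same for the monic `S`), `T_m(x) = T_n(x) = 0 ⟺ (m∕gcd, n∕gcd odd) ∧ T_{gcd}(x) = 0` (first-kind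
# Gauss–Chebyshev nodes), `T_m(x) = U_{n−1}(x) = 0 ⟺ (n∕gcd even) ∧ T_{gcd}(x) = 0` (mixed), and for the Dickson polynomials `C_m(x) = C_n(x) = 0 ⟺ C_{gcd}(x) = 0 ∧ (m∕gcd, n∕gcd odd ∨ 2 = 0
# in R)` — the generic principle being that the common zeros of `f, g` are the common zeros of any other generating set of the ideal `(f, g)`

HONEST FRAMING. Part of the Lean index of the computation cell `pub-hsemireg` (seat p10 gen 48, Sunday typer «UNIFORM-IN-n»).  Polynomial ∕ ideal algebra only; no variety, no cohomology theory,
no sheaf, no Ext group and no semiregularity map is constructed here; nothing here says that HC / HC_CM / HC_AV holds; no Literature fact (unproved `Prop`) is declared or used.  Custodian versions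
as in `WedgeHankelSiegelIdeal` (1/3).
SOURCES (cited).  T. J. Rivlin, *Chebyshev Polynomials* (1990), §1.2 and Ex. 1.5 (coincidences of the zeros `cos((2j−1)π∕2m)`, `cos(jπ∕n)`); M. O. Rayes, V. Trevisan, P. S. Wang, Comput. Math. Appl.
50 (2005) 1231–1240.
PROOF TYPED HERE.  Mathlib `Ideal.mem_span_pair`, `Ideal.mem_span_singleton`, `Ideal.subset_span`, `Ideal.eq_top_iff_one`, `eval_add ∕ eval_mul`; N457, N458, N462, N465, N466 (the ideal identities).
DEDUP DISCLOSURE (`rg -n 'common_root_iff_of_span_pair|no_common_root_of_span_pair|chebyshevU_common_root_iff|chebyshevS_common_root_iff|chebyshevT_common_root_iff|chebyshevTU_common_root_iff|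
chebyshevC_common_root_iff' Summits Literature HarnessLib`, 2026-09-04): N454 ∕ N459 ∕ N463 are the REAL `∃ x` statements (`ℝ`, cosines); here pointwise over any ring; 0 hits for the 8 names below.

WHAT IS IN THE TREE.  N454, N457, N458, N459, N462, N463, N465, N466.
THIS FILE (namespace `Summit.Ventures.HSemireg.Wedge.HankelOuter` continued; CHAINED on N469; 0 definitions):
* §1235 `common_root_iff_of_span_pair_eq`, `common_root_iff_of_span_pair_eq_span_singleton`, `no_common_root_of_span_pair_eq_top`, **`chebyshevU_common_root_iff`**, **`chebyshevS_common_root_iff`**,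
  **`chebyshevT_common_root_iff`**, **`chebyshevTU_common_root_iff`**, **`chebyshevC_common_root_iff`**.
CAVEATS.  `Nontrivial R` where a unit ideal must have no zero.  Nothing Ext-side.  New names only.
-/

open Module Polynomial
open scoped Matrix Polynomial

namespace Summit.Ventures.HSemireg.Wedge.HankelOuter

/-! ## §1235. Common zeros from the ideal identities -/

/-- Generic principle: if `(f, g) = (h₁, h₂)` as ideals then `f, g` and `h₁, h₂` have the same common zeros (any commutative ring). [this file, §1235] -/
theorem common_root_iff_of_span_pair_eq {A : Type*} [CommRing A] {f g h₁ h₂ : A[X]} (H : Ideal.span {f, g} = Ideal.span {h₁, h₂}) (x : A) :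
    (f.eval x = 0 ∧ g.eval x = 0) ↔ (h₁.eval x = 0 ∧ h₂.eval x = 0) := by
  have key : ∀ {p q r : A[X]}, r ∈ Ideal.span {p, q} → p.eval x = 0 → q.eval x = 0 → r.eval x = 0 := by
    intro p q r hr hp hq
    obtain ⟨a, b, hab⟩ := Ideal.mem_span_pair.1 hr
    rw [← hab, eval_add, eval_mul, eval_mul, hp, hq, mul_zero, mul_zero, add_zero]
  constructor
  · rintro ⟨hf, hg⟩
    exact ⟨key (H ▸ Ideal.subset_span (Set.mem_insert _ _)) hf hg, key (H ▸ Ideal.subset_span (Set.mem_insert_of_mem _ (Set.mem_singleton _))) hf hg⟩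
  · rintro ⟨h1, h2⟩
    exact ⟨key (H.symm ▸ Ideal.subset_span (Set.mem_insert _ _)) h1 h2, key (H.symm ▸ Ideal.subset_span (Set.mem_insert_of_mem _ (Set.mem_singleton _))) h1 h2⟩

/-- If `(f, g) = (h)` then the common zeros of `f, g` are the zeros of `h`. [this file, §1235] -/
theorem common_root_iff_of_span_pair_eq_span_singleton {A : Type*} [CommRing A] {f g h : A[X]} (H : Ideal.span {f, g} = Ideal.span {h}) (x : A) :
    (f.eval x = 0 ∧ g.eval x = 0) ↔ h.eval x = 0 := by
  rw [← Set.pair_eq_singleton h] at H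
  rw [common_root_iff_of_span_pair_eq H, and_self]

/-- If `(f, g) = (1)` in a nontrivial ring then `f, g` have no common zero. [this file, §1235] -/
theorem no_common_root_of_span_pair_eq_top {A : Type*} [CommRing A] [Nontrivial A] {f g : A[X]} (H : Ideal.span {f, g} = ⊤) (x : A) : ¬ (f.eval x = 0 ∧ g.eval x = 0) := by
  rintro ⟨hf, hg⟩
  obtain ⟨a, b, hab⟩ := Ideal.mem_span_pair.1 ((Ideal.eq_top_iff_one _).1 H)
  have e := congrArg (Polynomial.eval x) hab
  rw [eval_add, eval_mul, eval_mul, hf, hg, mul_zero, mul_zero, add_zero, eval_one] at e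
  exact zero_ne_one e

/-- **`U_{m−1}(x) = U_{n−1}(x) = 0 ⟺ U_{gcd(m,n)−1}(x) = 0`** for every `x` in every commutative ring (shared second-kind ∕ Fejér nodes = nodes of the `gcd` rule). [this file, §1235] -/
theorem chebyshevU_common_root_iff {R : Type*} [CommRing R] (m n : ℕ) (x : R) :
    ((Polynomial.Chebyshev.U R ((m : ℤ) - 1)).eval x = 0 ∧ (Polynomial.Chebyshev.U R ((n : ℤ) - 1)).eval x = 0) ↔ (Polynomial.Chebyshev.U R ((Nat.gcd m n : ℤ) - 1)).eval x = 0 :=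
  common_root_iff_of_span_pair_eq_span_singleton (chebyshevU_span_pair_eq_span_gcd m n) x

/-- **`S_{m−1}(x) = S_{n−1}(x) = 0 ⟺ S_{gcd(m,n)−1}(x) = 0`** for every `x` in every commutative ring. [this file, §1235] -/
theorem chebyshevS_common_root_iff {R : Type*} [CommRing R] (m n : ℕ) (x : R) :
    ((Polynomial.Chebyshev.S R ((m : ℤ) - 1)).eval x = 0 ∧ (Polynomial.Chebyshev.S R ((n : ℤ) - 1)).eval x = 0) ↔ (Polynomial.Chebyshev.S R ((Nat.gcd m n : ℤ) - 1)).eval x = 0 :=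
  common_root_iff_of_span_pair_eq_span_singleton (chebyshevS_span_pair_eq_span_gcd m n) x

/-- **`T_m(x) = T_n(x) = 0 ⟺ (m ∕ gcd, n ∕ gcd both odd) ∧ T_{gcd(m,n)}(x) = 0`** for every `x` in every nontrivial commutative ring (shared Gauss–Chebyshev nodes). [Rivlin Ex. 1.5; this file, §1235] -/
theorem chebyshevT_common_root_iff {R : Type*} [CommRing R] [Nontrivial R] (m n : ℕ) (x : R) :
    ((Polynomial.Chebyshev.T R (m : ℤ)).eval x = 0 ∧ (Polynomial.Chebyshev.T R (n : ℤ)).eval x = 0) ↔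
      (Odd (m / Nat.gcd m n) ∧ Odd (n / Nat.gcd m n)) ∧ (Polynomial.Chebyshev.T R (Nat.gcd m n : ℤ)).eval x = 0 := by
  by_cases hP : Odd (m / Nat.gcd m n) ∧ Odd (n / Nat.gcd m n)
  · rw [common_root_iff_of_span_pair_eq_span_singleton (chebyshevT_span_pair_eq_span_gcd hP) x]
    exact ⟨fun h => ⟨hP, h⟩, fun h => h.2⟩
  · exact ⟨fun h => absurd h (no_common_root_of_span_pair_eq_top (chebyshevT_span_pair_eq_top hP) x), fun h => absurd h.1 hP⟩

/-- **`T_m(x) = U_{n−1}(x) = 0 ⟺ (n ∕ gcd even) ∧ T_{gcd(m,n)}(x) = 0`** for every `x` in every nontrivial commutative ring (shared first- ∕ second-kind nodes). [this file, §1235] -/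
theorem chebyshevTU_common_root_iff {R : Type*} [CommRing R] [Nontrivial R] (m n : ℕ) (x : R) :
    ((Polynomial.Chebyshev.T R (m : ℤ)).eval x = 0 ∧ (Polynomial.Chebyshev.U R ((n : ℤ) - 1)).eval x = 0) ↔
      Even (n / Nat.gcd m n) ∧ (Polynomial.Chebyshev.T R (Nat.gcd m n : ℤ)).eval x = 0 := by
  by_cases hP : Even (n / Nat.gcd m n)
  · rw [common_root_iff_of_span_pair_eq_span_singleton (chebyshevTU_span_pair_eq_span_gcd hP) x]
    exact ⟨fun h => ⟨hP, h⟩, fun h => h.2⟩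
  · exact ⟨fun h => absurd h (no_common_root_of_span_pair_eq_top (chebyshevTU_span_pair_eq_top hP) x), fun h => absurd h.1 hP⟩

/-- **`C_m(x) = C_n(x) = 0 ⟺ C_{gcd(m,n)}(x) = 0 ∧ (m ∕ gcd, n ∕ gcd both odd ∨ 2 = 0 in R)`** for every `x` in every commutative ring (Dickson polynomials; the second alternative is the
characteristic-`2` collapse of the ideal `(2, C_g)`). [this file, §1235] -/
theorem chebyshevC_common_root_iff {R : Type*} [CommRing R] (m n : ℕ) (x : R) :
    ((Polynomial.Chebyshev.C R (m : ℤ)).eval x = 0 ∧ (Polynomial.Chebyshev.C R (n : ℤ)).eval x = 0) ↔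
      (Polynomial.Chebyshev.C R (Nat.gcd m n : ℤ)).eval x = 0 ∧ ((Odd (m / Nat.gcd m n) ∧ Odd (n / Nat.gcd m n)) ∨ (2 : R) = 0) := by
  by_cases hP : Odd (m / Nat.gcd m n) ∧ Odd (n / Nat.gcd m n)
  · rw [common_root_iff_of_span_pair_eq_span_singleton (chebyshevC_span_pair_eq_span_gcd hP) x]
    exact ⟨fun h => ⟨h, Or.inl hP⟩, fun h => h.1⟩
  · rw [common_root_iff_of_span_pair_eq (chebyshevC_span_pair_eq_span_two_gcd hP) x, show (2 : R[X]) = Polynomial.C 2 from (Polynomial.C_ofNat 2).symm, eval_C]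
    exact ⟨fun h => ⟨h.2, Or.inr h.1⟩, fun h => ⟨h.2.resolve_left hP, h.1⟩⟩

end Summit.Ventures.HSemireg.Wedge.HankelOuter
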